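import Summits.ResolutionOfSingularities.ResolutionOfSingularities.Theorems.RisoStrataRisoCentresResolvePCuspTools
import Literature.AlgebraicGeometry.Resolution.RegularLocalRingsNormal

/-!
# Route RisoStrata — crux `RisoCentresResolve` (stmt-ResolutionOfSingularities-18546), line `Sketch`:
# the `p`-cusp surface `B = k[x^p, y, xy]` is NOT regular along its singular line

Lead c2, stub `pcusp_not_isRegularLocalRing`. For `char k = p`, `K = k(X₀, X₁)`, `x = X₀`,
`y = X₁` and `B = k[x^p, y, xy] ⊆ K` (the toric surface `w^p = u y^p`, `u = x^p`, `w = xy`),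
the local ring `B_m` at every maximal ideal `m ∋ x^p - c^p, y, xy` is not a regular local ring.

Route (no dimension theory, no monomial bookkeeping):
* a regular local ring is integrally closed (Matsumura 19.4, tree file
  `Literature/…/RegularLocalRingsNormal.lean`); `z := xy / y` in `Frac(B_m)` satisfies
  `z^p = x^p ∈ B`, so regularity would give `x = a/s` with `a ∈ B`, `s ∈ B ∖ m`
  (`pcusp_not_isRegularLocalRing`);
* but `s ∈ B`, `x·s ∈ B` forces `s ∈ m` (`pcn_mem_of_X_mul`): under the evaluation
  `ε : X₀ ↦ X, X₁ ↦ 0` into `k[X]` the algebra `B` lands in the polynomials with vanishing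
  derivative (`ε(x^p) = X^p` has derivative `p X^{p-1} = 0`), and `(X f)' = f + X f'`, so
  `ε(s) = 0`; hence `s(c, 0) = 0`, while every element of `B` is congruent modulo
  `(x^p - c^p, y, xy) ⊆ m` to its value at `(c, 0)` (`fin_residue`).
Mathlib + tree only; no definitions, no named facts.
-/

noncomputable section

set_option linter.dupNamespace false

namespace Summit.ResolutionOfSingularities.ResolutionOfSingularities.Theorems

open Summit.ResolutionOfSingularities.ResolutionOfSingularities.Theses.RisoStrata

section PCuspNotRegular

variable {k : Type} [Field k]

/-- A `k`-algebra map `B → A` for `B ⊆ k[X₀,X₁] ⊆ k(X₀,X₁)` from an evaluation `X_i ↦ v i`,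
with its values on polynomial elements (generalises `pc_exists_arc`). -/
theorem pcn_exists_hom {A : Type} [CommRing A] [Algebra k A] (v : Fin 2 → A)
    (B : Subalgebra k (FractionRing (MvPolynomial (Fin 2) k)))
    (hB : B ≤ (IsScalarTower.toAlgHom k (MvPolynomial (Fin 2) k)
      (FractionRing (MvPolynomial (Fin 2) k))).range) :
    ∃ α : ↥B →ₐ[k] A, ∀ (b : ↥B) (q : MvPolynomial (Fin 2) k),
      (b : FractionRing (MvPolynomial (Fin 2) k)) =
        algebraMap (MvPolynomial (Fin 2) k) (FractionRing (MvPolynomial (Fin 2) k)) q →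
      α b = MvPolynomial.aeval v q := by
  set ι := IsScalarTower.toAlgHom k (MvPolynomial (Fin 2) k) (FractionRing (MvPolynomial (Fin 2) k))
    with hι
  set e := AlgEquiv.ofInjective ι pc_iota_injective with he
  refine ⟨(MvPolynomial.aeval v).comp
    ((e.symm : ↥ι.range →ₐ[k] MvPolynomial (Fin 2) k).comp (Subalgebra.inclusion hB)), ?_⟩
  intro b q hbq
  have hincl : Subalgebra.inclusion hB b = e q := by
    apply Subtype.ext
    rw [Subalgebra.coe_inclusion, he, AlgEquiv.ofInjective_apply]
    exact hbq
  rw [AlgHom.comp_apply, AlgHom.comp_apply, hincl]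
  exact congrArg _ (e.symm_apply_apply q)

/-- `(X f)' = f + X f'`: a polynomial `f` with `f' = 0` and `(X f)' = 0` vanishes. -/
theorem pcn_eq_zero_of_derivative {f : Polynomial k} (h1 : Polynomial.derivative f = 0)
    (h2 : Polynomial.derivative (Polynomial.X * f) = 0) : f = 0 := by
  rwa [Polynomial.derivative_mul, Polynomial.derivative_X, one_mul, h1, mul_zero, add_zero] at h2

/-- **Conductor step.** In `B = k[x^p, y, xy] ⊆ k(x, y)` (`char k = p`): if `s ∈ B` and
`x·s ∈ B`, then `s` lies in every ideal `m` of `B` containing `x^p - c^p`, `y`, `xy`.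
Proof: the evaluation `X₀ ↦ X, X₁ ↦ 0` maps `B` into `{f ∈ k[X] : f' = 0}`, so it kills `s`
(`pcn_eq_zero_of_derivative`); hence `s(c, 0) = 0`, and `s ≡ s(c, 0) (mod (x^p - c^p, y, xy))`. -/
theorem pcn_mem_of_X_mul (p : ℕ) [Fact p.Prime] [CharP k p] (c : k)
    (B : Subalgebra k (FractionRing (MvPolynomial (Fin 2) k)))
    (hB : B = Algebra.adjoin k {(algebraMap (MvPolynomial (Fin 2) k)
      (FractionRing (MvPolynomial (Fin 2) k)) (MvPolynomial.X 0)) ^ p,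
      algebraMap (MvPolynomial (Fin 2) k) (FractionRing (MvPolynomial (Fin 2) k))
        (MvPolynomial.X 1),
      algebraMap (MvPolynomial (Fin 2) k) (FractionRing (MvPolynomial (Fin 2) k))
        (MvPolynomial.X 0) * algebraMap (MvPolynomial (Fin 2) k)
          (FractionRing (MvPolynomial (Fin 2) k)) (MvPolynomial.X 1)})
    (m : Ideal ↥B)
    (hPm : ∀ b : ↥B, ((b : FractionRing (MvPolynomial (Fin 2) k)) =
        (algebraMap (MvPolynomial (Fin 2) k) (FractionRing (MvPolynomial (Fin 2) k))
          (MvPolynomial.X 0)) ^ p - algebraMap k (FractionRing (MvPolynomial (Fin 2) k)) (c ^ p) ∨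
      (b : FractionRing (MvPolynomial (Fin 2) k)) =
        algebraMap (MvPolynomial (Fin 2) k) (FractionRing (MvPolynomial (Fin 2) k))
          (MvPolynomial.X 1) ∨
      (b : FractionRing (MvPolynomial (Fin 2) k)) =
        algebraMap (MvPolynomial (Fin 2) k) (FractionRing (MvPolynomial (Fin 2) k))
          (MvPolynomial.X 0) * algebraMap (MvPolynomial (Fin 2) k)
            (FractionRing (MvPolynomial (Fin 2) k)) (MvPolynomial.X 1)) → b ∈ m)
    (s a : ↥B)
    (has : (a : FractionRing (MvPolynomial (Fin 2) k)) =
      algebraMap (MvPolynomial (Fin 2) k) (FractionRing (MvPolynomial (Fin 2) k))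
        (MvPolynomial.X 0) * (s : FractionRing (MvPolynomial (Fin 2) k))) :
    s ∈ m := by
  set K := FractionRing (MvPolynomial (Fin 2) k) with hKdef
  set x : K := algebraMap (MvPolynomial (Fin 2) k) K (MvPolynomial.X 0) with hxdef
  set y : K := algebraMap (MvPolynomial (Fin 2) k) K (MvPolynomial.X 1) with hydef
  -- the polynomial ring inside K
  set ι := IsScalarTower.toAlgHom k (MvPolynomial (Fin 2) k) K with hιdef
  have hcK : algebraMap k K (c ^ p) = algebraMap (MvPolynomial (Fin 2) k) K
      (MvPolynomial.C (c ^ p)) := by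
    rw [IsScalarTower.algebraMap_apply k (MvPolynomial (Fin 2) k) K, MvPolynomial.algebraMap_eq]
  -- memberships
  have hxpB : x ^ p ∈ B := hB ▸ Algebra.subset_adjoin (by simp)
  have hyB : y ∈ B := hB ▸ Algebra.subset_adjoin (by simp)
  have hxyB : x * y ∈ B := hB ▸ Algebra.subset_adjoin (by simp)
  -- the three coordinates
  obtain ⟨P0, hP0K⟩ : ∃ P0 : ↥B, (P0 : K) = x ^ p - algebraMap k K (c ^ p) :=
    ⟨⟨x ^ p, hxpB⟩ - algebraMap k ↥B (c ^ p), by simp [Subalgebra.coe_algebraMap]; rfl⟩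
  set P1 : ↥B := ⟨y, hyB⟩ with hP1def
  set P2 : ↥B := ⟨x * y, hxyB⟩ with hP2def
  have hP1K : (P1 : K) = y := rfl
  have hP2K : (P2 : K) = x * y := rfl
  have hP0m : P0 ∈ m := hPm _ (Or.inl hP0K)
  have hP1m : P1 ∈ m := hPm _ (Or.inr (Or.inl hP1K))
  have hP2m : P2 ∈ m := hPm _ (Or.inr (Or.inr hP2K))
  obtain ⟨P, hPP0, hPP1, hPP2⟩ : ∃ P : Fin 3 → ↥B, P 0 = P0 ∧ P 1 = P1 ∧ P 2 = P2 :=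
    ⟨![P0, P1, P2], rfl, rfl, rfl⟩
  have hPm' : ∀ j, P j ∈ m := by
    intro j; fin_cases j
    · exact hPP0 ▸ hP0m
    · exact hPP1 ▸ hP1m
    · exact hPP2 ▸ hP2m
  -- B sits inside the polynomial ring
  have hBle : B ≤ ι.range := by
    rw [hB, Algebra.adjoin_le_iff]
    intro z hz
    simp only [Set.mem_insert_iff, Set.mem_singleton_iff] at hz
    rcases hz with rfl | rfl | rfl
    · exact ⟨MvPolynomial.X 0 ^ p, by rw [map_pow]; rfl⟩
    · exact ⟨MvPolynomial.X 1, rfl⟩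
    · exact ⟨MvPolynomial.X 0 * MvPolynomial.X 1, by rw [map_mul]; rfl⟩
  -- the coordinates generate B
  have hPgenK : Algebra.adjoin k (Set.range fun i => (P i : K)) = B := by
    apply le_antisymm
    · rw [Algebra.adjoin_le_iff]
      rintro _ ⟨i, rfl⟩
      exact (P i).2
    · have h0 : (P0 : K) ∈ Algebra.adjoin k (Set.range fun i => (P i : K)) :=
        Algebra.subset_adjoin ⟨0, by simp only [hPP0]⟩
      have h1' : (P1 : K) ∈ Algebra.adjoin k (Set.range fun i => (P i : K)) :=
        Algebra.subset_adjoin ⟨1, by simp only [hPP1]⟩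
      have h2' : (P2 : K) ∈ Algebra.adjoin k (Set.range fun i => (P i : K)) :=
        Algebra.subset_adjoin ⟨2, by simp only [hPP2]⟩
      conv_lhs => rw [hB]
      rw [Algebra.adjoin_le_iff]
      intro z hz
      simp only [Set.mem_insert_iff, Set.mem_singleton_iff] at hz
      rcases hz with rfl | rfl | rfl
      · have : x ^ p = (P0 : K) + algebraMap k K (c ^ p) := by rw [hP0K, sub_add_cancel]
        rw [this]
        exact add_mem h0 (Subalgebra.algebraMap_mem _ _)
      · exact hP1K ▸ h1'
      · exact hP2K ▸ h2'
  have hPgen : Algebra.adjoin k (Set.range P) = ⊤ := adjoin_range_eq_top_of_adjoin_coe_eq B P hPgenK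
  -- the evaluation X₀ ↦ X, X₁ ↦ 0 into k[X]
  obtain ⟨α, hα⟩ := pcn_exists_hom ![(Polynomial.X : Polynomial k), 0] B hBle
  have hα0 : α P0 = Polynomial.X ^ p - Polynomial.C (c ^ p) := by
    rw [hα P0 (MvPolynomial.X 0 ^ p - MvPolynomial.C (c ^ p))
      (by rw [map_sub, map_pow, hP0K, hcK])]
    rw [map_sub, map_pow, MvPolynomial.aeval_X, MvPolynomial.aeval_C, Polynomial.algebraMap_eq]
    rfl
  have hα1 : α P1 = 0 := by
    rw [hα P1 (MvPolynomial.X 1) (by rw [hP1K])]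
    rw [MvPolynomial.aeval_X]; rfl
  have hα2 : α P2 = 0 := by
    rw [hα P2 (MvPolynomial.X 0 * MvPolynomial.X 1) (by rw [hP2K, map_mul])]
    rw [map_mul, MvPolynomial.aeval_X, MvPolynomial.aeval_X]
    exact mul_eq_zero_of_right _ rfl
  -- α(B) consists of polynomials with vanishing derivative
  have hder : ∀ b : ↥B, Polynomial.derivative (α b) = 0 := by
    intro b
    have hb : b ∈ Algebra.adjoin k (Set.range P) := by rw [hPgen]; exact Algebra.mem_top
    refine Algebra.adjoin_induction (p := fun b _ => Polynomial.derivative (α b) = 0)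
      ?_ ?_ ?_ ?_ hb
    · rintro _ ⟨j, rfl⟩
      fin_cases j
      · show Polynomial.derivative (α (P 0)) = 0
        rw [hPP0, hα0, map_sub, Polynomial.derivative_X_pow, CharP.cast_eq_zero, map_zero,
          zero_mul, Polynomial.derivative_C, sub_zero]
      · show Polynomial.derivative (α (P 1)) = 0
        rw [hPP1, hα1, map_zero]
      · show Polynomial.derivative (α (P 2)) = 0
        rw [hPP2, hα2, map_zero]
    · intro r
      rw [AlgHom.commutes, Polynomial.algebraMap_eq, Polynomial.derivative_C]
    · intro u v _ _ hu hv
      rw [map_add, map_add, hu, hv, add_zero]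
    · intro u v _ _ hu hv
      rw [map_mul, Polynomial.derivative_mul, hu, hv, zero_mul, mul_zero, add_zero]
  -- hence α s = 0
  have hαs : α s = 0 := by
    obtain ⟨q, hq⟩ := hBle s.2
    have hq' : (s : K) = algebraMap (MvPolynomial (Fin 2) k) K q := hq.symm
    have hαa : α a = Polynomial.X * α s := by
      rw [hα a (MvPolynomial.X 0 * q) (by rw [map_mul, has, hq']), hα s q hq', map_mul,
        MvPolynomial.aeval_X]
      rfl
    have h := hder a
    rw [hαa] at h
    exact pcn_eq_zero_of_derivative (hder s) h
  -- evaluation at the point (c, 0) kills P0, P1, P2 and s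
  set β : ↥B →ₐ[k] k := (Polynomial.aeval c).comp α with hβ
  have hβP : ∀ j, β (P j) = 0 := by
    intro j; fin_cases j
    · show β (P 0) = 0
      rw [hPP0, hβ, AlgHom.comp_apply, hα0, map_sub, map_pow, Polynomial.aeval_X,
        Polynomial.aeval_C, Algebra.algebraMap_self_apply, sub_self]
    · show β (P 1) = 0
      rw [hPP1, hβ, AlgHom.comp_apply, hα1, map_zero]
    · show β (P 2) = 0
      rw [hPP2, hβ, AlgHom.comp_apply, hα2, map_zero]
  have hβs : β s = 0 := by rw [hβ, AlgHom.comp_apply, hαs, map_zero]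
  -- s ≡ d mod (P), and d = β s = 0
  obtain ⟨d, hd⟩ := fin_residue (Ideal.span (Set.range P)) P
    (fun j => Ideal.subset_span ⟨j, rfl⟩) hPgen s
  have hspan_le : Ideal.span (Set.range P) ≤ m :=
    Ideal.span_le.mpr (by rintro _ ⟨j, rfl⟩; exact hPm' j)
  have hker : Ideal.span (Set.range P) ≤ RingHom.ker (β : ↥B →+* k) :=
    Ideal.span_le.mpr (by rintro _ ⟨j, rfl⟩; exact hβP j)
  have hd0 : d = 0 := by
    have h := hker hd
    rw [RingHom.mem_ker, RingHom.coe_coe, map_sub, hβs, AlgHom.commutes,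
      Algebra.algebraMap_self_apply, zero_sub, neg_eq_zero] at h
    exact h
  rw [hd0, map_zero, sub_zero] at hd
  exact hspan_le hd

/-- **Normality step** (abstract): if a localisation `L` of a domain `B` at `M` is a regular
local ring, then a relation `P₂ ^ n = U · P₁ ^ n` (`n > 0`, `P₁ ≠ 0`) in `B` forces
`P₂ / P₁ ∈ L`, i.e. `a · P₁ = P₂ · s` for some `a ∈ B`, `s ∈ M`: `z := P₂ / P₁ ∈ Frac L` has
`z ^ n = U`, so it is integral over `L`, and a regular local ring is integrally closed
(Matsumura, Thm. 19.4). -/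
theorem pcn_exists_of_isRegularLocalRing {B L : Type} [CommRing B] [IsDomain B] [CommRing L]
    [Algebra B L] (M : Submonoid B) [IsLocalization M L] (hM : M ≤ nonZeroDivisors B)
    [IsRegularLocalRing L] {n : ℕ} (hn : 0 < n) (U P1 P2 : B) (hrel : P2 ^ n = U * P1 ^ n)
    (hP10 : P1 ≠ 0) : ∃ (a : B) (s : M), a * P1 = P2 * s := by
  haveI : IsDomain L := IsLocalization.isDomain_of_le_nonZeroDivisors L hM
  haveI : IsIntegrallyClosed L :=
    Literature.AlgebraicGeometry.Resolution.isIntegrallyClosed_of_isRegularLocalRing L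
  set g := algebraMap B L with hgdef
  set f := algebraMap L (FractionRing L) with hfdef
  have hg : Function.Injective g := IsLocalization.injective L hM
  have hf : Function.Injective f := IsFractionRing.injective L (FractionRing L)
  have hfg1 : f (g P1) ≠ 0 := by
    intro h
    apply hP10
    apply hg
    apply hf
    rw [h, map_zero, map_zero]
  -- z := P2 / P1 is integral over L (z ^ n = U), hence lies in L
  set z : FractionRing L := f (g P2) / f (g P1) with hz
  have hzp : z ^ n = f (g U) := by
    rw [hz, div_pow, ← map_pow, ← map_pow, ← map_pow, ← map_pow, hrel, map_mul, map_mul, map_pow,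
      map_pow, mul_div_assoc, div_self (pow_ne_zero _ hfg1), mul_one]
  have hint : IsIntegral L z := by
    refine IsIntegral.of_pow hn ?_
    rw [hzp]
    exact isIntegral_algebraMap
  obtain ⟨w, hw⟩ := IsIntegrallyClosed.algebraMap_eq_of_integral hint
  obtain ⟨a, s, rfl⟩ := IsLocalization.exists_mk'_eq M w
  -- clear denominators
  have h1 : f (g a) = z * f (g (s : B)) := by
    rw [← IsLocalization.mk'_spec L a s, map_mul, hw]
  have h2 : f (g (a * P1)) = f (g (P2 * (s : B))) := by
    rw [map_mul, map_mul, map_mul, map_mul, h1, hz, div_mul_eq_mul_div, div_mul_cancel₀ _ hfg1]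
  exact ⟨a, s, hg (hf h2)⟩

/-- **The `p`-cusp surface is not regular along its singular line** (lead c2, stub
`pcusp_not_isRegularLocalRing` of line `Sketch`).  Let `k` have characteristic `p`,
`K = k(X₀, X₁)`, `x = X₀`, `y = X₁`, `B = k[x^p, y, xy] ⊆ K` (the toric surface `w^p = u y^p`,
`u = x^p`, `w = xy`, whose normalisation is the affine plane `k[x, y]`).  For every maximal ideal
`m` of `B` containing `x^p - c^p`, `y`, `xy` the local ring `B_m` is NOT a regular local ring:
a regular local ring is integrally closed (Matsumura, Thm. 19.4), the element `z = xy / y` of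
`Frac(B_m)` has `z^p = x^p ∈ B`, so it would lie in `B_m`, i.e. `x·s ∈ B` for some
`s ∈ B ∖ m` — impossible by the conductor step `pcn_mem_of_X_mul` (`x·s ∈ B ⟹ s ∈ m`).
Consequently the letters of a riso schedule collapse at these points (`risoCen B d ≤ m`).
(The hypothesis `c ≠ 0` is not needed: the vertex `c = 0` is singular as well.) [folklore] -/
theorem pcusp_not_isRegularLocalRing : ∀ (p : ℕ) [Fact p.Prime] (k : Type) [Field k] [CharP k p] (c : k), c ≠ 0 → ∀ (B : Subalgebra k (FractionRing (MvPolynomial (Fin 2) k))), B = Algebra.adjoin k {(algebraMap (MvPolynomial (Fin 2) k) (FractionRing (MvPolynomial (Fin 2) k)) (MvPolynomial.X 0)) ^ p, algebraMap (MvPolynomial (Fin 2) k) (FractionRing (MvPolynomial (Fin 2) k)) (MvPolynomial.X 1), algebraMap (MvPolynomial (Fin 2) k) (FractionRing (MvPolynomial (Fin 2) k)) (MvPolynomial.X 0) * algebraMap (MvPolynomial (Fin 2) k) (FractionRing (MvPolynomial (Fin 2) k)) (MvPolynomial.X 1)} → ∀ (m : Ideal ↥B) (hm : m.IsMaximal),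 (∀ b : ↥B, ((b : FractionRing (MvPolynomial (Fin 2) k)) = (algebraMap (MvPolynomial (Fin 2) k) (FractionRing (MvPolynomial (Fin 2) k)) (MvPolynomial.X 0)) ^ p - algebraMap k (FractionRing (MvPolynomial (Fin 2) k)) (c ^ p) ∨ (b : FractionRing (MvPolynomial (Fin 2) k)) = algebraMap (MvPolynomial (Fin 2) k) (FractionRing (MvPolynomial (Fin 2) k)) (MvPolynomial.X 1) ∨ (b : FractionRing (MvPolynomial (Fin 2) k)) = algebraMap (MvPolynomial (Fin 2) k) (FractionRing (MvPolynomial (Fin 2) k)) (MvPolynomial.X 0) * algebraMap (MvPolynomial (Fin 2) k) (FractionRing (MvPolynomial (Fin 2) k)) (MvPolynomial.X 1)) → b ∈ m) → ¬ IsRegularLocalRing (Localization (@Ideal.primeCompl ↥B _ m hm.isPrime)) := by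
  intro p _ k _ _ c _ B hB m hm hPm hreg
  haveI : m.IsPrime := hm.isPrime
  set K := FractionRing (MvPolynomial (Fin 2) k) with hKdef
  set x : K := algebraMap (MvPolynomial (Fin 2) k) K (MvPolynomial.X 0) with hxdef
  set y : K := algebraMap (MvPolynomial (Fin 2) k) K (MvPolynomial.X 1) with hydef
  -- memberships and the relation (xy)^p = x^p · y^p in B
  have hxpB : x ^ p ∈ B := hB ▸ Algebra.subset_adjoin (by simp)
  have hyB : y ∈ B := hB ▸ Algebra.subset_adjoin (by simp)
  have hxyB : x * y ∈ B := hB ▸ Algebra.subset_adjoin (by simp)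
  set U : ↥B := ⟨x ^ p, hxpB⟩ with hUdef
  set P1 : ↥B := ⟨y, hyB⟩ with hP1def
  set P2 : ↥B := ⟨x * y, hxyB⟩ with hP2def
  have hrel : P2 ^ p = U * P1 ^ p := by
    apply Subtype.ext
    rw [Subalgebra.coe_mul, SubmonoidClass.coe_pow, SubmonoidClass.coe_pow]
    exact mul_pow x y p
  have hy0 : y ≠ 0 := by
    intro h
    refine MvPolynomial.X_ne_zero (R := k) (1 : Fin 2) ?_
    exact IsFractionRing.injective (MvPolynomial (Fin 2) k) K (by rw [map_zero]; exact h)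
  have hP10 : P1 ≠ 0 := fun h => hy0 (congrArg Subtype.val h)
  -- normality step in the localisation, then the conductor step
  obtain ⟨a, s, h3⟩ := pcn_exists_of_isRegularLocalRing (L := Localization m.primeCompl)
    m.primeCompl m.primeCompl_le_nonZeroDivisors (Fact.out : p.Prime).pos U P1 P2 hrel hP10
  have h4 : (a : K) = x * ((s : ↥B) : K) := by
    have h := congrArg Subtype.val h3
    simp only [Subalgebra.coe_mul] at h
    apply mul_right_cancel₀ hy0
    rw [h]
    ring
  exact s.2 (pcn_mem_of_X_mul p c B hB m hPm (s : ↥B) a h4)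

end PCuspNotRegular

end Summit.ResolutionOfSingularities.ResolutionOfSingularities.Theorems

end
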